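import Summits.Ventures.PercRepro.ProfileGapMonoGenericB
import Summits.Ventures.PercRepro.ProfileGapMonoOneAll

/-!
# PercRepro — `(GM)_2` AT EVERY `2`-GENERIC POINT BELOW THE TOP LEVEL (p5, gen 21; `proofs/P5-GM1.md` §10,
the instance `q = 2` of the generic template with p10's co-rank-`1` row `profileIneqMinusQ_one_all`)

At a point `z` lying in no cocircuit `D` with `ρ(D ∖ z) ≤ 2` (`GenericAt M z 2`), for every `3 ≤ u ≤ ρ(E) − 1`,
the co-rank-`2` gap is deletion-monotone at `z`: the template reduces it to the co-rank-`1` row of `M ／ z` at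
level `u − 1`, a theorem of the tree.  With `gapMonoQ_top` (`u = ρ(E)`) this is `(GM)_2` at every `2`-generic point
of rank `≥ u`; what the rule `GapMonoRuleQ α 2 u` still needs is ONE gap-monotone point in every simple matroid
all of whose points lie in a small cocircuit (a coloop, a series pair, or a cocircuit inside a line).

* **`gapMonoQ_two_of_genericAt`**.
-/

open scoped Matroid

namespace PercRepro.Cogirth

open Finset ThmH Skew Shadow Profile

variable {α : Type} [DecidableEq α] {M : Matroid α} [M.Finite]

/-- **`(GM)_2` at a `2`-generic point**, `3 ≤ u ≤ ρ(E) − 1`. -/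
theorem gapMonoQ_two_of_genericAt {z : α} {u : ℕ} (hz : z ∈ gr M) (hz1 : rk M {z} = 1)
    (hgen : GenericAt M z 2) (hu : 3 ≤ u) (hR : u + 1 ≤ rk M (gr M)) : GapMonoQ M z 2 u :=
  gapMonoQ_of_genericAt hz hz1 hgen (by norm_num) (by omega) (by omega)
    (profileIneqMinusQ_one_all (M ／ ({z} : Set α)) (by omega))

end PercRepro.Cogirth
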